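import Summits.CriticalPhenomena.PercolationContinuityZ3.Theorems.Transplant.SkelPhiFaceRouteNums3
import Summits.CriticalPhenomena.PercolationContinuityZ3.Theorems.Transplant.SkelPhiFaceTargetMM2
import Summits.CriticalPhenomena.PercolationContinuityZ3.Theorems.Transplant.SkelPhiFaceSchedBoxes
import Summits.CriticalPhenomena.PercolationContinuityZ3.Theorems.Transplant.SkelPhiRectAt
import HarnessLib

/-!
# N1 ({±1} node), (F) inner route, part R5b-vi (hp-8 g33): **THE SMART CONSTRUCTOR OF THE PER-CENTRE NUMBERS AT AN x-FACE** —
# `FaceRunNums3 … true c …` (target `targetMM`, habitat `farCore`) from: the run data `yL yT Nr N₃ σT` and the reading boxes, the contact's cell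
# bounds (`Llo ≤ lev(z_c) ≤ Lhi`), the footprint-box choices tied to the cell (`flo/fhi/fw`, `glo/ghi/gw`), and the purely NUMERIC fields passed
# through; the constructor DISCHARGES every graph-geometric field: the run origins `cL, cT` (`exists_mem_graphBall_φ_eq`), the habitat conversion
# `hPlfoot` (`mem_farCore_of_footBox`), the target conversion `hMfoot` (`mem_targetMM_of_cellBox`), the zone clearance `hMZ`
# (`disjoint_targetMM_of_near`), and the schedule boxes `hprism/hprismY/hlastc` (`SkelPhiFaceSchedBoxes`).
builds on p205010 (kernel theorem, internal audit signed; external expert review pending) — nothing in this file uses p205010; no claim about the open node.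
Lane `prim-bschramm`, seat `prim-hp-8` (gen 33); helper file (`--supports stmt-CriticalPhenomena-4575 --as helper`).
* **`Skelφ.faceRunNums3_x_mk`** (per-region readings, cell-box target: `FaceRunNums3`).
[cite: KozmaNitzan2024, §4 Lemma 11 (pp. 22–23), Lemma 12 (pp. 23–25)] [cite: MartineauTassion2017, §4.3 Lemma 4.2]
-/

noncomputable section

open scoped Classical

namespace Summit.CriticalPhenomena.PercolationContinuityZ3.Theorems.Transplant

namespace Skelφ

open Literature.Probability.Percolation Literature.Probability.LatticeModels SimpleGraph KNCells
open Literature.Probability.Percolation.KozmaNitzan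
open Literature.Probability.Percolation.KozmaNitzan.Cells (oth oth_ne sgOf sgOf_sign stepVec_apply_fst eq_oth_of_ne oth_oth)
open KNLevels ChainPlanar ChainPara
open Literature.Barriers.CriticalPhenomena (graphBall mem_graphBall_self graphBall_mono)
open BoxProdZ2 (ConcRadiiG)
open TwoAxis.Para (modulus)

variable {V : Type} [DecidableEq V] {G : SimpleGraph V} [G.LocallyFinite] {φ : V → Site 2}

/-- **THE SMART CONSTRUCTOR OF THE PER-CENTRE NUMBERS AT AN x-FACE** (see the module docstring). -/
theorem faceRunNums3_x_mk (hstep : Steps G φ) (pr : FinePrm) (w₀ : V) {nL : ℕ} (hn : pr.n = nL) (hnL : 1 ≤ nL) (hvL : |pr.vα| ≤ nL)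
    (hD : 0 < pr.D) (hlipψ : Lip G (pr.ψ φ w₀)) (hws : WeakSteps G (pr.ψ φ w₀))
    (P : PCells2) (Λ : ConcRadiiG) (b₀ : Fin 2 → ℕ) (a' : ℕ) (x : Site 2) (du : MDir) (j : ℕ) {L' : ℕ} (hL' : 1 ≤ L')
    (hrM : L' ≤ Λ.rM a' (x + stepVec du)) {k₀ : ℤ} (hk₀ : 0 ≤ k₀) {r : ℕ} (c : V) (hcw : c ∈ graphBall G w₀ (Λ.rE a' x du - r))
    (hrE : r ≤ Λ.rE a' x du) (kb : ℕ)
    -- the contact's cell, the footprint boxes tied to it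
    {Llo Lhi wc : ℤ} (hLlo : Llo ≤ P.lev du x (pr.ψ φ w₀ c)) (hLhi : P.lev du x (pr.ψ φ w₀ c) ≤ Lhi)
    (hwc : |pr.ψ φ w₀ c (oth du.1) - P.cen x (oth du.1)| ≤ wc)
    {flo fhi fw : ℤ} (hflo : 5 * (P.r du.1 : ℤ) + 10 * P.s du.1 * j + 3 ≤ flo + Llo) (hfhi : fhi + Lhi ≤ 25 * P.r du.1 - 2)
    (hfw : fw + wc + k₀ + 1 ≤ 5 * (P.r (oth du.1) : ℤ) - 3) {LLO LHI : Site 2}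
    (hglo : ∀ i, P.cen (x + stepVec du) i - b₀ i + 2 ≤ LLO i + pr.ψ φ w₀ c i) (hghi : ∀ i, LHI i + pr.ψ φ w₀ c i ≤ P.cen (x + stepVec du) i + b₀ i - 2)
    {kpar kperp : ℤ} (hfR : flo ≤ -kpar ∧ kpar ≤ fhi ∧ kperp ≤ fw)
    -- the near zone
    (Zc : Finset V) {kZ : ℤ} (hZk : ∀ v ∈ Zc, |pr.ψ φ c v du.1| ≤ kZ) (hZfar : Lhi + kZ + 1 < 20 * (P.r du.1 : ℤ) - b₀ du.1)
    -- the run data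
    (B : BridgePrm) (ℓ' R's qB R'₃ qB₃ : ℕ) (hlay : (nL + pr.h.natAbs : ℕ) ≤ (nL : ℤ) * ℓ' + 1) (yL yT : Site 2) (Nr N₃ : ℕ) {σT : ℤ}
    (hσT : σT = 1 ∨ σT = -1) (PLO PHI YLO YHI : ℕ → Site 2)
    {paLo pbLo paHi pbHi yaLo ybLo yaHi ybHi : ℕ → ℤ} {laLo lbLo laHi lbHi : ℤ}
    (hreg : ∀ k ≤ Nr, (xRunSched nL ℓ' pr.h R's qB Nr).region k ⊆ Finset.Icc (pt (paLo k) (pbLo k)) (pt (paHi k) (pbHi k)))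
    (hregY : ∀ k ≤ N₃, (yRunSched hnL hvL hlay R'₃ qB₃ N₃).region k ⊆ Finset.Icc (pt (yaLo k) (ybLo k)) (pt (yaHi k) (ybHi k)))
    (hlastc : (yRunSched hnL hvL hlay R'₃ qB₃ N₃).core (N₃ + 1) ⊆ Finset.Icc (pt laLo lbLo) (pt laHi lbHi))
    (hP0 : ∀ k ≤ Nr, PLO k 0 ≤ TwoAxis.Para.coarse pr.c₀ (pr.D / 2) pr.D (TwoAxis.Para.lam0 pr.A pr.vα pr.vβ yL) +
      (pr.c₀ * (pr.A * (modulus nL pr.h pr.vα pr.vβ * (min (sgOf du * paLo k) (sgOf du * paHi k)) -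
      max (pr.vα * ((shearUnit nL pr.h : ℤ) * (min (sgOf du * pbLo k) (sgOf du * pbHi k) - 1)))
      (pr.vα * ((shearUnit nL pr.h : ℤ) * (max (sgOf du * pbLo k) (sgOf du * pbHi k)) + shearUnit nL pr.h - 1))) / nL)) / pr.D)
    (hP1 : ∀ k ≤ Nr, TwoAxis.Para.coarse pr.c₀ (pr.D / 2) pr.D (TwoAxis.Para.lam0 pr.A pr.vα pr.vβ yL) +
      (pr.c₀ * (pr.A * (modulus nL pr.h pr.vα pr.vβ * (max (sgOf du * paLo k) (sgOf du * paHi k)) -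
      min (pr.vα * ((shearUnit nL pr.h : ℤ) * (min (sgOf du * pbLo k) (sgOf du * pbHi k) - 1)))
      (pr.vα * ((shearUnit nL pr.h : ℤ) * (max (sgOf du * pbLo k) (sgOf du * pbHi k)) + shearUnit nL pr.h - 1))) / nL)) / pr.D
      + 1 ≤ PHI k 0)
    (hP2 : ∀ k ≤ Nr, PLO k 1 ≤ TwoAxis.Para.coarse pr.c₁ (pr.D / 2) pr.D (TwoAxis.Para.lam1 pr.A nL pr.h yL) +
      (pr.c₁ * (pr.A * ((shearUnit nL pr.h : ℤ) * (min (sgOf du * pbLo k) (sgOf du * pbHi k) - 1)))) / pr.D)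
    (hP3 : ∀ k ≤ Nr, TwoAxis.Para.coarse pr.c₁ (pr.D / 2) pr.D (TwoAxis.Para.lam1 pr.A nL pr.h yL) +
      (pr.c₁ * (pr.A * ((shearUnit nL pr.h : ℤ) * (max (sgOf du * pbLo k) (sgOf du * pbHi k)) + shearUnit nL pr.h - 1))) / pr.D + 1
      ≤ PHI k 1)
    (hPf₁ : ∀ k ≤ Nr, sgOf du = 1 → flo ≤ PLO k du.1 ∧ PHI k du.1 ≤ fhi)
    (hPf₂ : ∀ k ≤ Nr, sgOf du = -1 → flo ≤ -PHI k du.1 ∧ -PLO k du.1 ≤ fhi)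
    (hPf₃ : ∀ k ≤ Nr, -fw ≤ PLO k (oth du.1) ∧ PHI k (oth du.1) ≤ fw)
    (hY0 : ∀ k ≤ N₃, YLO k 0 ≤ TwoAxis.Para.coarse pr.c₀ (pr.D / 2) pr.D (TwoAxis.Para.lam0 pr.A pr.vα pr.vβ yT) +
      (pr.c₀ * (pr.A * (modulus nL pr.h pr.vα pr.vβ * (min (σT * ybLo k) (σT * ybHi k)) -
      max (pr.vα * ((shearUnit nL pr.h : ℤ) * (min (σT * yaLo k) (σT * yaHi k) - 1)))
      (pr.vα * ((shearUnit nL pr.h : ℤ) * (max (σT * yaLo k) (σT * yaHi k)) + shearUnit nL pr.h - 1))) / nL)) / pr.D)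
    (hY1 : ∀ k ≤ N₃, TwoAxis.Para.coarse pr.c₀ (pr.D / 2) pr.D (TwoAxis.Para.lam0 pr.A pr.vα pr.vβ yT) +
      (pr.c₀ * (pr.A * (modulus nL pr.h pr.vα pr.vβ * (max (σT * ybLo k) (σT * ybHi k)) -
      min (pr.vα * ((shearUnit nL pr.h : ℤ) * (min (σT * yaLo k) (σT * yaHi k) - 1)))
      (pr.vα * ((shearUnit nL pr.h : ℤ) * (max (σT * yaLo k) (σT * yaHi k)) + shearUnit nL pr.h - 1))) / nL)) / pr.D
      + 1 ≤ YHI k 0)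
    (hY2 : ∀ k ≤ N₃, YLO k 1 ≤ TwoAxis.Para.coarse pr.c₁ (pr.D / 2) pr.D (TwoAxis.Para.lam1 pr.A nL pr.h yT) +
      (pr.c₁ * (pr.A * ((shearUnit nL pr.h : ℤ) * (min (σT * yaLo k) (σT * yaHi k) - 1)))) / pr.D)
    (hY3 : ∀ k ≤ N₃, TwoAxis.Para.coarse pr.c₁ (pr.D / 2) pr.D (TwoAxis.Para.lam1 pr.A nL pr.h yT) +
      (pr.c₁ * (pr.A * ((shearUnit nL pr.h : ℤ) * (max (σT * yaLo k) (σT * yaHi k)) + shearUnit nL pr.h - 1))) / pr.D + 1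
      ≤ YHI k 1)
    (hYf₁ : ∀ k ≤ N₃, sgOf du = 1 → flo ≤ YLO k du.1 ∧ YHI k du.1 ≤ fhi)
    (hYf₂ : ∀ k ≤ N₃, sgOf du = -1 → flo ≤ -YHI k du.1 ∧ -YLO k du.1 ≤ fhi)
    (hYf₃ : ∀ k ≤ N₃, -fw ≤ YLO k (oth du.1) ∧ YHI k (oth du.1) ≤ fw)
    (hL0 : LLO 0 ≤ TwoAxis.Para.coarse pr.c₀ (pr.D / 2) pr.D (TwoAxis.Para.lam0 pr.A pr.vα pr.vβ yT) +
      (pr.c₀ * (pr.A * (modulus nL pr.h pr.vα pr.vβ * (min (σT * lbLo) (σT * lbHi)) -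
      max (pr.vα * ((shearUnit nL pr.h : ℤ) * (min (σT * laLo) (σT * laHi) - 1)))
      (pr.vα * ((shearUnit nL pr.h : ℤ) * (max (σT * laLo) (σT * laHi)) + shearUnit nL pr.h - 1))) / nL)) / pr.D)
    (hL1 : TwoAxis.Para.coarse pr.c₀ (pr.D / 2) pr.D (TwoAxis.Para.lam0 pr.A pr.vα pr.vβ yT) +
      (pr.c₀ * (pr.A * (modulus nL pr.h pr.vα pr.vβ * (max (σT * lbLo) (σT * lbHi)) -
      min (pr.vα * ((shearUnit nL pr.h : ℤ) * (min (σT * laLo) (σT * laHi) - 1)))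
      (pr.vα * ((shearUnit nL pr.h : ℤ) * (max (σT * laLo) (σT * laHi)) + shearUnit nL pr.h - 1))) / nL)) / pr.D
      + 1 ≤ LHI 0)
    (hL2 : LLO 1 ≤ TwoAxis.Para.coarse pr.c₁ (pr.D / 2) pr.D (TwoAxis.Para.lam1 pr.A nL pr.h yT) +
      (pr.c₁ * (pr.A * ((shearUnit nL pr.h : ℤ) * (min (σT * laLo) (σT * laHi) - 1)))) / pr.D)
    (hL3 : TwoAxis.Para.coarse pr.c₁ (pr.D / 2) pr.D (TwoAxis.Para.lam1 pr.A nL pr.h yT) +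
      (pr.c₁ * (pr.A * ((shearUnit nL pr.h : ℤ) * (max (σT * laLo) (σT * laHi)) + shearUnit nL pr.h - 1))) / pr.D + 1
      ≤ LHI 1)
    (hxaX : ∀ x ∈ Finset.Icc B.core1Lo B.core1Hi, |x 0 - sgOf du * yL 0| ≤ qB)
    (hxbX : ∀ x ∈ Finset.Icc B.core1Lo B.core1Hi,
      |sgOf du * ((nL : ℤ) * (x 1 - yL 1) - pr.h * (sgOf du * x 0 - yL 0))| + shearUnit nL pr.h ≤ ((nL * ℓ' / shearUnit nL pr.h + 1 : ℕ) : ℤ) * shearUnit nL pr.h)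
    (hxyX : ∀ a s : ℤ, (xPrmW nL ℓ' pr.h R's qB Nr).aLo (Nr + 1) ≤ a → a ≤ (xPrmW nL ℓ' pr.h R's qB Nr).aHi (Nr + 1) →
      (xPrmW nL ℓ' pr.h R's qB Nr).bLo (Nr + 1) ≤ s / (shearUnit nL pr.h : ℤ) → s / (shearUnit nL pr.h : ℤ) ≤ (xPrmW nL ℓ' pr.h R's qB Nr).bHi (Nr + 1) →
      (yPrmW nL ℓ' pr.h pr.vα R'₃ qB₃ N₃).InCore 0 ((σT * sgOf du * s - σT * ((nL : ℤ) * (yT - yL) 1 - pr.h * (yT - yL) 0)) / (shearUnit nL pr.h : ℤ))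
      (σT * sgOf du * a - σT * (yT - yL) 0))
    (hclr : ∀ k ≤ Nr, (kb : ℤ) < paLo k + sgOf du * yL 0)
    (hclr₃ : ∀ k ≤ N₃, ∀ b : ℤ, min (σT * ybLo k) (σT * ybHi k) ≤ b →
      b ≤ max (σT * ybLo k) (σT * ybHi k) → (kb : ℤ) < sgOf du * (b + yT 0))
    (hπ2X : ((yL 0).natAbs + (yL 1).natAbs) + (Nr + 1) * shearUnit nL pr.h ≤ r)
    (hπ3X : ∀ k ≤ N₃, ((yT 0).natAbs + (yT 1).natAbs) + (((((k + 1 : ℕ) : ℤ) * pr.vα).natAbs +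
      (((shearUnit nL pr.h : ℤ) * |((k + 1 : ℕ) : ℤ) * (yPrmW nL ℓ' pr.h pr.vα R'₃ qB₃ N₃).sLo| + |pr.h| * |((k + 1 : ℕ) : ℤ) * pr.vα| + shearUnit nL pr.h) / nL).natAbs + 1))
      ≤ r)
    : Nonempty (FaceRunNums3 G φ (pr.ψ φ w₀) true c pr.A nL pr.h pr.vα pr.vβ pr.c₀ pr.c₁ pr.D du (sgOf du) B ℓ' R's qB R'₃ qB₃ pr.vα hnL hvL hlay kb
        (P.farCore x du j k₀) (targetMM G φ pr P w₀ Λ b₀ a' x du L') Zc r kpar kperp) := by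
  -- the fine maps in the structure's spelling
  have eψ : ∀ t, pr.ψ φ t = fineSkel φ t pr.A (nL : ℤ) pr.h pr.vα pr.vβ pr.c₀ pr.c₁ (pr.D / 2) (pr.D / 2) pr.D := fun t => by
    simp only [FinePrm.ψ, hn]
  -- the run origins
  obtain ⟨cL, hcLπ, hcLφ⟩ := exists_mem_graphBall_φ_eq hstep c (φ c + yL)
  obtain ⟨cT, hcTπ, hcTφ⟩ := exists_mem_graphBall_φ_eq hstep c (φ c + yT)
  simp only [Pi.add_apply, add_sub_cancel_left] at hcLπ hcTπ
  -- the inner ball inside the outer ball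
  have hball : ∀ {w : V}, w ∈ graphBall G c r → w ∈ graphBall G w₀ (Λ.rE a' x du) := by
    intro w hw
    have h2 := BoxProdZ2.mem_graphBall_add G hcw hw
    rwa [Nat.sub_add_cancel hrE] at h2
  refine ⟨
    { cL := cL,
      cT := cT,
      yL := yL,
      yT := yT,
      RcL := (yL 0).natAbs + (yL 1).natAbs,
      RcT := (yT 0).natAbs + (yT 1).natAbs,
      Nr := Nr,
      N₃ := N₃,
      σT := σT,
      flo := flo,
      fhi := fhi,
      fw := fw,
      paLo := paLo,
      pbLo := pbLo,
      paHi := paHi,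
      pbHi := pbHi,
      PLO := PLO,
      PHI := PHI,
      yaLo := yaLo,
      ybLo := ybLo,
      yaHi := yaHi,
      ybHi := ybHi,
      laLo := laLo,
      lbLo := lbLo,
      laHi := laHi,
      lbHi := lbHi,
      YLO := YLO,
      YHI := YHI,
      LLO := LLO,
      LHI := LHI,
      hcLφ := hcLφ,
      hcTφ := hcTφ,
      hcLπ := hcLπ,
      hcTπ := hcTπ,
      hσT := hσT,
      hPlfoot := fun w _ hfb => ?_,
      hMfoot := fun w hw hfb => ?_,
      hMZ := ?_,
      hfR := hfR,
      hreg := hreg,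
      hregY := hregY,
      hlastc := hlastc,
      hP0 := hP0,
      hP1 := hP1,
      hP2 := hP2,
      hP3 := hP3,
      hPf₁ := hPf₁,
      hPf₂ := hPf₂,
      hPf₃ := hPf₃,
      hY0 := hY0,
      hY1 := hY1,
      hY2 := hY2,
      hY3 := hY3,
      hYf₁ := hYf₁,
      hYf₂ := hYf₂,
      hYf₃ := hYf₃,
      hL0 := hL0,
      hL1 := hL1,
      hL2 := hL2,
      hL3 := hL3,
      hxaX := fun _ => hxaX,
      hxbX := fun _ => hxbX,
      hxaY := fun h => absurd h (by decide),
      hxbY := fun h => absurd h (by decide),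
      hxyX := fun _ => hxyX,
      hxyY := fun h => absurd h (by decide),
      hclr := hclr,
      hclr₃ := hclr₃,
      hπ2X := fun _ => hπ2X,
      hπ2Y := fun h => absurd h (by decide),
      hπ3X := fun _ => hπ3X,
      hπ3Y := fun h => absurd h (by decide) }⟩
  · -- habitat conversion
    rw [eψ w₀]
    rw [eψ w₀] at hwc hLlo hLhi
    exact mem_farCore_of_footBox P w₀ c w pr.A (nL : ℤ) pr.h pr.vα pr.vβ pr.c₀ pr.c₁ hD hk₀ hfb hwc (by linarith) (by linarith) (by linarith)
  · -- target conversion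
    rw [← eψ c] at hfb
    exact mem_targetMM_of_cellBox c hL' hrM hD hlipψ hws (hball hw) hfb hglo hghi
  · -- the target is off the zone
    exact disjoint_targetMM_of_near c hD hZk hLhi hZfar

end Skelφ

end Summit.CriticalPhenomena.PercolationContinuityZ3.Theorems.Transplant

end
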